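import Mathlib
import HarnessLib

/-!
# LINE (A) `product_plus_one` (crux `MatrixDescartes`, stmt-ValiantsHypothesis-18050, V1) — W-CB engine: the TILT CORE
# (abstract lemmas (P1)–(P3) for the fast-knee shell; typed for val-lit-p8 g17's `…FastKneeShell`, memo §24/§25)

Abstract `S`-data as in ✓ `…ThetaShell.no_three_zeros_of_theta_sq_law`: on a window `(u, v) ⊂ (0, ∞)` a function `S` with θ-derivatives
`S₁ = θS`, `S₂ = θ²S` in the form `HasDerivAt S (S₁ x / x) x`, `HasDerivAt S₁ (S₂ x / x) x` (`θ = x·d/dx`) and the RATE LAW `p²·S < S₂`; a FAST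
rate `k` with `p < k` enters through a TILT `T` obeying the logistic θ-law `θT = (k/2)·(1 − T²)` — the model is `T(x) = (a·x^k − 1)/(a·x^k + 1)`,
`a > 0` (`hasDerivAt_tilt`) — and the TILTED SLOPE `G := S₁ + k·T·S`.

* §1 the tilt: `hasDerivAt_tilt` (`θT = (k/2)(1 − T²)`), `tilt_sq_lt_one` (`T² < 1`);
* §2 **(P1)** `hasDerivAt_tiltedSlope` (`θG = S₂ + (k²/2)(1 − T²)·S + k·T·S₁`), `theta_tiltedSlope_eq_at_zero` (`= S₂ − (k²/2)(3T² − 1)·S` at a zero of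
  `G`), ★ `theta_tiltedSlope_pos_of_core`: at a zero of `G` with `S > 0` in the CORE `3k²T² < 2p² + k²`, `θG > 0` (zeros of `G` are transversal,
  upward, in the core);
* §3 **(P2)** `hasDerivAt_rpow_neg_mul_slopePlus` / `hasDerivAt_rpow_mul_slopeMinus` (`(x^{−p}(S₁ + pS))′ = x^{−p−1}(S₂ − p²S)`,
  `(x^{p}(S₁ − pS))′ = x^{p−1}(S₂ − p²S)`), ★ `strictMonoOn_rpow_neg_mul_slopePlus` / ★ `strictMonoOn_rpow_mul_slopeMinus` (both strictly increasing
  on the window under the rate law), and the one-sided corollaries at a zero of `G` outside the core: `slopePlus_neg_of_tilt_gt` (`p < kT ⇒ S₁ + pS < 0`),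
  `slopeMinus_pos_of_tilt_lt` (`kT < −p ⇒ 0 < S₁ − pS`), with the threshold remark `lt_mul_tilt_of_sqrt_le` (`√((2p² + k²)/3) ≤ kT ⇒ p < kT` when
  `0 ≤ p < k`);
* §4 **(P3)** `xi_eq_two_mul_theta_tiltedSlope` — at a zero of `G`: `2S·S₂ − 3S₁² + k²S² = 2S·θG`.

Honest framing: pure one-variable calculus/algebra, a conditional engine for ONE W-cell route (T1 `OneFastKneeCellK3`); nothing here is a cell, NOT
`WronskianBudgetK3` / `OneChangeFloorK3` / `stub_classRowK3` / `stub_polyLaw` / `MatrixDescartes` / Conjecture B; `VP ≠ VNP` NOT proved.  No definitions,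
no named facts; Mathlib only. [folklore]
-/

set_option linter.dupNamespace false

namespace Summit.ValiantsHypothesis.ValiantsHypothesis.Theorems.LacunarySymmetroidMatrixDescartes

namespace ProductPlusOne

open Set
open scoped Topology

/-! ### §1 The tilt `T = (a·x^k − 1)/(a·x^k + 1)` -/

/-- `0 < a·x^k + 1` for `a > 0`, `x > 0`. [folklore] -/
theorem tilt_den_pos {a x : ℝ} (ha : 0 < a) (hx : 0 < x) (k : ℕ) : 0 < a * x ^ k + 1 := by positivity

/-- `T² < 1` for the tilt `T = (a·x^k − 1)/(a·x^k + 1)`, `a > 0`, `x > 0`. [folklore] -/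
theorem tilt_sq_lt_one {a x : ℝ} (ha : 0 < a) (hx : 0 < x) (k : ℕ) :
    ((a * x ^ k - 1) / (a * x ^ k + 1)) ^ 2 < 1 := by
  have hw : 0 < a * x ^ k := by positivity
  have hd : 0 < a * x ^ k + 1 := by linarith
  rw [div_pow, div_lt_one (by positivity)]
  nlinarith

/-- **The logistic θ-law of the tilt:** `θT = (k/2)·(1 − T²)`, i.e. `T′(x) = ((k/2)(1 − T(x)²))/x` (`a > 0`, `x > 0`, every `k : ℕ`).
[this file's lemma] -/
theorem hasDerivAt_tilt {a x : ℝ} (ha : 0 < a) (hx : 0 < x) (k : ℕ) :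
    HasDerivAt (fun y : ℝ => (a * y ^ k - 1) / (a * y ^ k + 1))
      (((k : ℝ) / 2) * (1 - ((a * x ^ k - 1) / (a * x ^ k + 1)) ^ 2) / x) x := by
  have hd : a * x ^ k + 1 ≠ 0 := (tilt_den_pos ha hx k).ne'
  have hw : HasDerivAt (fun y : ℝ => a * y ^ k) (a * ((k : ℝ) * x ^ (k - 1))) x :=
    (hasDerivAt_pow k x).const_mul a
  have hnum : HasDerivAt (fun y : ℝ => a * y ^ k - 1) (a * ((k : ℝ) * x ^ (k - 1))) x := hw.sub_const 1
  have hden : HasDerivAt (fun y : ℝ => a * y ^ k + 1) (a * ((k : ℝ) * x ^ (k - 1))) x := hw.add_const 1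
  refine (hnum.div hden hd).congr_deriv ?_
  rcases Nat.eq_zero_or_pos k with rfl | hk
  · simp
  · obtain ⟨j, rfl⟩ : ∃ j, k = j + 1 := ⟨k - 1, by omega⟩
    simp only [Nat.add_sub_cancel]
    field_simp
    ring

/-! ### §2 (P1) The tilted slope `G = S₁ + k·T·S`: θ-derivative and transversality in the core -/

section TiltedSlope

variable {S S₁ S₂ T : ℝ → ℝ} {p k x : ℝ}

/-- **`θG = S₂ + (k²/2)(1 − T²)·S + k·T·S₁`** for `G = S₁ + k·T·S`, given the θ-data of `S` and the logistic θ-law of `T`. [this file's lemma] -/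
theorem hasDerivAt_tiltedSlope (hx : x ≠ 0) (hS : HasDerivAt S (S₁ x / x) x) (hS₁ : HasDerivAt S₁ (S₂ x / x) x)
    (hT : HasDerivAt T ((k / 2) * (1 - T x ^ 2) / x) x) :
    HasDerivAt (fun y => S₁ y + k * T y * S y)
      ((S₂ x + (k ^ 2 / 2) * (1 - T x ^ 2) * S x + k * T x * S₁ x) / x) x := by
  have h := hS₁.add (((hT.const_mul k).mul hS))
  refine h.congr_deriv ?_
  field_simp
  ring

/-- **At a zero of `G`:** `S₂ + (k²/2)(1 − T²)·S + k·T·S₁ = S₂ − (k²/2)(3T² − 1)·S` (substitute `S₁ = −kT·S`). [this file's lemma] -/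
theorem theta_tiltedSlope_eq_at_zero (hG : S₁ x + k * T x * S x = 0) :
    S₂ x + (k ^ 2 / 2) * (1 - T x ^ 2) * S x + k * T x * S₁ x = S₂ x - (k ^ 2 / 2) * (3 * T x ^ 2 - 1) * S x := by
  have h1 : S₁ x = -(k * T x * S x) := by linarith
  rw [h1]
  ring

/-- ★ **(P1) TRANSVERSALITY IN THE CORE:** at a zero of `G = S₁ + k·T·S` with `S > 0`, under the rate law `p²·S < S₂`, inside the core
`3k²T² < 2p² + k²` one has `θG > 0` (so, for `x > 0`, `G` crosses zero UPWARD there). [this file's theorem] -/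
theorem theta_tiltedSlope_pos_of_core (hlaw : p ^ 2 * S x < S₂ x) (hSx : 0 < S x) (hG : S₁ x + k * T x * S x = 0)
    (hcore : 3 * k ^ 2 * T x ^ 2 < 2 * p ^ 2 + k ^ 2) :
    0 < S₂ x + (k ^ 2 / 2) * (1 - T x ^ 2) * S x + k * T x * S₁ x := by
  rw [theta_tiltedSlope_eq_at_zero hG]
  nlinarith [mul_pos hSx (sub_pos.2 hcore)]

/-- **(P1), derivative form:** under the same hypotheses and `x > 0`, with the θ-data of `S` and the logistic law of `T`, the derivative of `G`
at its zero is POSITIVE. [this file's theorem] -/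
theorem deriv_tiltedSlope_pos_of_core (hx : 0 < x) (hS : HasDerivAt S (S₁ x / x) x) (hS₁ : HasDerivAt S₁ (S₂ x / x) x)
    (hT : HasDerivAt T ((k / 2) * (1 - T x ^ 2) / x) x) (hlaw : p ^ 2 * S x < S₂ x) (hSx : 0 < S x)
    (hG : S₁ x + k * T x * S x = 0) (hcore : 3 * k ^ 2 * T x ^ 2 < 2 * p ^ 2 + k ^ 2) :
    0 < deriv (fun y => S₁ y + k * T y * S y) x := by
  rw [(hasDerivAt_tiltedSlope hx.ne' hS hS₁ hT).deriv]
  exact div_pos (theta_tiltedSlope_pos_of_core hlaw hSx hG hcore) hx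

end TiltedSlope

/-! ### §3 (P2) One-sided monotonicity of `x^{−p}(S₁ + pS)` and `x^{p}(S₁ − pS)` -/

section OneSided

variable {S S₁ S₂ : ℝ → ℝ} {p : ℝ}

/-- `(x^{−p}·(S₁ + p·S))′ = x^{−p−1}·(S₂ − p²·S)` (`x > 0`). [this file's lemma] -/
theorem hasDerivAt_rpow_neg_mul_slopePlus {x : ℝ} (hx : 0 < x) (hS : HasDerivAt S (S₁ x / x) x)
    (hS₁ : HasDerivAt S₁ (S₂ x / x) x) :
    HasDerivAt (fun y : ℝ => y ^ (-p) * (S₁ y + p * S y)) (x ^ (-p - 1) * (S₂ x - p ^ 2 * S x)) x := by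
  have hr : HasDerivAt (fun y : ℝ => y ^ (-p)) (-p * x ^ (-p - 1)) x := Real.hasDerivAt_rpow_const (Or.inl hx.ne')
  have hN : HasDerivAt (fun y : ℝ => S₁ y + p * S y) (S₂ x / x + p * (S₁ x / x)) x := hS₁.add (hS.const_mul p)
  refine (hr.mul hN).congr_deriv ?_
  have e1 : x ^ (-p) = x ^ (-p - 1) * x := by
    rw [Real.rpow_sub hx, Real.rpow_one]; field_simp
  rw [e1]
  field_simp
  ring

/-- `(x^{p}·(S₁ − p·S))′ = x^{p−1}·(S₂ − p²·S)` (`x > 0`). [this file's lemma] -/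
theorem hasDerivAt_rpow_mul_slopeMinus {x : ℝ} (hx : 0 < x) (hS : HasDerivAt S (S₁ x / x) x)
    (hS₁ : HasDerivAt S₁ (S₂ x / x) x) :
    HasDerivAt (fun y : ℝ => y ^ p * (S₁ y - p * S y)) (x ^ (p - 1) * (S₂ x - p ^ 2 * S x)) x := by
  have hr : HasDerivAt (fun y : ℝ => y ^ p) (p * x ^ (p - 1)) x := Real.hasDerivAt_rpow_const (Or.inl hx.ne')
  have hN : HasDerivAt (fun y : ℝ => S₁ y - p * S y) (S₂ x / x - p * (S₁ x / x)) x := hS₁.sub (hS.const_mul p)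
  refine (hr.mul hN).congr_deriv ?_
  have e1 : x ^ p = x ^ (p - 1) * x := by
    rw [Real.rpow_sub hx, Real.rpow_one]; field_simp
  rw [e1]
  field_simp
  ring

/-- ★ **(P2a)** Under the rate law `p²·S < S₂` on `(u, v) ⊂ (0, ∞)`, `x ↦ x^{−p}·(S₁ + p·S)` is STRICTLY INCREASING on the window.
[this file's theorem] -/
theorem strictMonoOn_rpow_neg_mul_slopePlus {u v : ℝ} (hu : 0 ≤ u) (hS : ∀ x ∈ Ioo u v, HasDerivAt S (S₁ x / x) x)
    (hS₁ : ∀ x ∈ Ioo u v, HasDerivAt S₁ (S₂ x / x) x) (hlaw : ∀ x ∈ Ioo u v, p ^ 2 * S x < S₂ x) :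
    StrictMonoOn (fun y : ℝ => y ^ (-p) * (S₁ y + p * S y)) (Ioo u v) := by
  have hpos : ∀ x ∈ Ioo u v, 0 < x := fun x hx => hu.trans_lt hx.1
  refine strictMonoOn_of_deriv_pos (convex_Ioo u v)
    (fun x hx => (hasDerivAt_rpow_neg_mul_slopePlus (hpos x hx) (hS x hx) (hS₁ x hx)).continuousAt.continuousWithinAt)
    fun x hx => ?_
  rw [interior_Ioo] at hx
  rw [(hasDerivAt_rpow_neg_mul_slopePlus (hpos x hx) (hS x hx) (hS₁ x hx)).deriv]
  exact mul_pos (Real.rpow_pos_of_pos (hpos x hx) _) (sub_pos.2 (hlaw x hx))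

/-- ★ **(P2b)** Under the rate law `p²·S < S₂` on `(u, v) ⊂ (0, ∞)`, `x ↦ x^{p}·(S₁ − p·S)` is STRICTLY INCREASING on the window.
[this file's theorem] -/
theorem strictMonoOn_rpow_mul_slopeMinus {u v : ℝ} (hu : 0 ≤ u) (hS : ∀ x ∈ Ioo u v, HasDerivAt S (S₁ x / x) x)
    (hS₁ : ∀ x ∈ Ioo u v, HasDerivAt S₁ (S₂ x / x) x) (hlaw : ∀ x ∈ Ioo u v, p ^ 2 * S x < S₂ x) :
    StrictMonoOn (fun y : ℝ => y ^ p * (S₁ y - p * S y)) (Ioo u v) := by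
  have hpos : ∀ x ∈ Ioo u v, 0 < x := fun x hx => hu.trans_lt hx.1
  refine strictMonoOn_of_deriv_pos (convex_Ioo u v)
    (fun x hx => (hasDerivAt_rpow_mul_slopeMinus (hpos x hx) (hS x hx) (hS₁ x hx)).continuousAt.continuousWithinAt)
    fun x hx => ?_
  rw [interior_Ioo] at hx
  rw [(hasDerivAt_rpow_mul_slopeMinus (hpos x hx) (hS x hx) (hS₁ x hx)).deriv]
  exact mul_pos (Real.rpow_pos_of_pos (hpos x hx) _) (sub_pos.2 (hlaw x hx))

/-- **(P2) corollary, `T > 0` side:** at a zero of `G = S₁ + k·T·S` with `S > 0` and `p < k·T`, `S₁ + p·S < 0`. [this file's lemma] -/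
theorem slopePlus_neg_of_tilt_gt {T : ℝ → ℝ} {k x : ℝ} (hG : S₁ x + k * T x * S x = 0) (hSx : 0 < S x) (hkT : p < k * T x) :
    S₁ x + p * S x < 0 := by
  nlinarith [mul_pos hSx (sub_pos.2 hkT)]

/-- **(P2) corollary, `T < 0` side:** at a zero of `G` with `S > 0` and `k·T < −p`, `0 < S₁ − p·S`. [this file's lemma] -/
theorem slopeMinus_pos_of_tilt_lt {T : ℝ → ℝ} {k x : ℝ} (hG : S₁ x + k * T x * S x = 0) (hSx : 0 < S x) (hkT : k * T x < -p) :
    0 < S₁ x - p * S x := by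
  nlinarith [mul_pos hSx (sub_pos.2 hkT)]

/-- **Threshold remark:** outside the core on the `T > 0` side, `√((2p² + k²)/3) ≤ k·T` gives `p < k·T` (for `0 ≤ p < k`); symmetrically
`k·T ≤ −√((2p² + k²)/3)` gives `k·T < −p`. [this file's lemma] -/
theorem lt_mul_tilt_of_sqrt_le {k t : ℝ} (hp : 0 ≤ p) (hpk : p < k) (h : Real.sqrt ((2 * p ^ 2 + k ^ 2) / 3) ≤ k * t) :
    p < k * t := by
  have hk : 0 < k := hp.trans_lt hpk
  have hlt : p < Real.sqrt ((2 * p ^ 2 + k ^ 2) / 3) := by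
    rw [Real.lt_sqrt hp]
    nlinarith [mul_pos (sub_pos.2 hpk) (add_pos_of_nonneg_of_pos hp hk)]
  exact hlt.trans_le h

/-- The symmetric threshold remark on the `T < 0` side. [this file's lemma] -/
theorem mul_tilt_lt_neg_of_le_neg_sqrt {k t : ℝ} (hp : 0 ≤ p) (hpk : p < k)
    (h : k * t ≤ -Real.sqrt ((2 * p ^ 2 + k ^ 2) / 3)) : k * t < -p := by
  have hk : 0 < k := hp.trans_lt hpk
  have hlt : p < Real.sqrt ((2 * p ^ 2 + k ^ 2) / 3) := by
    rw [Real.lt_sqrt hp]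
    nlinarith [mul_pos (sub_pos.2 hpk) (add_pos_of_nonneg_of_pos hp hk)]
  linarith

end OneSided

/-! ### §4 (P3) The curvature identity at a zero of `G` -/

/-- ★ **(P3)** at a zero of `G = S₁ + k·T·S`: `Ξ := 2S·S₂ − 3S₁² + k²S² = 2S·θG` with `θG = S₂ + (k²/2)(1 − T²)S + k·T·S₁`. [this file's lemma] -/
theorem xi_eq_two_mul_theta_tiltedSlope {S S₁ S₂ T : ℝ → ℝ} {k x : ℝ} (hG : S₁ x + k * T x * S x = 0) :
    2 * S x * S₂ x - 3 * S₁ x ^ 2 + k ^ 2 * S x ^ 2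
      = 2 * S x * (S₂ x + (k ^ 2 / 2) * (1 - T x ^ 2) * S x + k * T x * S₁ x) := by
  have h1 : S₁ x = -(k * T x * S x) := by linarith
  rw [h1]
  ring

end ProductPlusOne

end Summit.ValiantsHypothesis.ValiantsHypothesis.Theorems.LacunarySymmetroidMatrixDescartes
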